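import Literature.Probability.Percolation.ArmEventsAPriori
import HarnessLib

/-!
# The two-arm scaling-limit fact reduced to Smirnov–Werner's (16) and (9) on integer data

Topic `Literature/Probability/Percolation`; family `crit-perc`. Companion of
`ArmExponentsTwoArm.lean` (theorems only: no new definitions, no new named facts). That file
records Smirnov–Werner's continuum input for the two-arm exponent as the named fact
`SmirnovWerner2001_twoArm_scalingLimit` (S. Smirnov, W. Werner, *Critical exponents for
two-dimensional percolation*, Math. Res. Lett. 8 (2001) 729–744, §4; equation numbers of the
arXiv text `math/0109120`): there is `b' : ℝ → ℝ` with
`b_2(ρ r, ρ R) → b'(R/r)` (`ρ → ∞`) for all integers `1 ≤ r < R` — SW (16), "`b_j(ρr, ρR)` has a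
scaling limit, which is conformally invariant, and so depends on the ratio `R/r` only" — and
`log b'(λ) / log λ → -1/4` (`λ → ∞`) — SW (9) with (15), `j = 2`.

The fact packages two printed statements into one real function `b'`. Here we PROVE that the
packaging is free, i.e. that the fact is equivalent to the conjunction of the two statements
read on integer data only (`SmirnovWerner2001_twoArm_scalingLimit_iff`):

* (16)ℕ  for all integers `1 ≤ r < R` the limit `L(r, R) = lim_ρ b_2(ρ r, ρ R)` exists;
* (9)ℕ   `log L(1, n) / log n → -1/4` along the integers `n → ∞`.

The two observations behind this are elementary and are those of the source:
* *dependence on the ratio only is automatic along integer dilations*: `b_2(ρ k r, ρ k R)` is a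
  subsequence of `b_2(ρ r, ρ R)`, so `L(k r, k R) = L(r, R)` (`limit_mul`), whence
  `L(r, R) = L(r', R')` whenever `R/r = R'/r'` (`limit_eq_of_ratio_eq`) — SW: "and so depends on
  the ratio `R/r` only";
* *the exponent transfers from integer to rational ratios by monotonicity*: `b_2(r, R)` is
  non-increasing in `R` (`polyArmProb_anti_holds`, SW §3) and non-decreasing in `r`
  (`armEvent_mono_left`), so `q ↦ L(q)` is non-increasing on the rationals `q > 1`
  (`limit_anti_ratio`) and `L(1, n+1) ≤ L(q) ≤ L(1, n)` for `n ≤ q < n + 1`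
  (`exponent_of_nat`); off the rationals `b'` is unconstrained by (16) and is taken to be
  `λ^{-1/4}`.
Along the way the RSW a-priori bounds of `ArmEventsAPriori.lean` pass to the limit
(`exists_rpow_le_limit`, `exists_limit_le_rpow`, `limit_pos`): this is SW's sentence following
(16), "By standard RSW theory, `b_j(r, R)` is bounded from below by a power of `R/r`, hence
`b'_j(R) ≥ const R^{-ζ}` for some `ζ > 0`" (p. 9 of the arXiv text).

What remains for `SmirnovWerner2001_twoArm_scalingLimit_holds` is thus exactly (16)ℕ — the
existence of the scaling limit of the two-arm probabilities of the integer annuli (Smirnov's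
theorem and the Camia–Newman full scaling limit; in the tree the named facts
`convergesInLawToSLE_six_triInterface`, `exists_isCNLFamily_tendsto`) — and (9)ℕ — the
`SLE₆` annulus-disconnection exponent `1/4` (SW (12)–(13), Lawler–Schramm–Werner) transported
to `L(1, n)`. Neither is proved here.

## Contents (namespace `Literature.Probability.Percolation`, helpers in `TwoArmScalingLimit`)

* `TwoArmScalingLimit.limit_mul`, `limit_eq_of_ratio_eq` — ratio-only dependence of the limits.
* `TwoArmScalingLimit.limit_anti_right`, `limit_mono_left`, `limit_anti_ratio` — monotonicity.
* `TwoArmScalingLimit.exists_rpow_le_limit`, `exists_limit_le_rpow`, `limit_pos`,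
  `limit_le_one` — a-priori bounds of the limits (SW p. 9).
* `TwoArmScalingLimit.exponent_of_nat` — (9)ℕ along integers implies the exponent `-1/4`
  uniformly over all integer pairs of large ratio.
* `SmirnovWerner2001_twoArm_scalingLimit_of_limits`,
  `SmirnovWerner2001_twoArm_scalingLimit_of_limits_nat`,
  `SmirnovWerner2001_twoArm_scalingLimit_iff` — the reduction and the equivalence.

Mathlib: `Filter.Tendsto`, `tendsto_nhds_unique`, `le_of_tendsto_of_tendsto`, `ge_of_tendsto`,
`Metric.tendsto_atTop`, `Real.log`, `Real.rpow`. Tree: `critTwoArmProb`,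
`SmirnovWerner2001_twoArm_scalingLimit`, `TwoArmAssembly.div_le_div_of_nonpos_left'`
(`ArmExponentsTwoArm.lean`), `polyArmProb_anti_holds`, `armEvent_mono_left`,
`polyArmProb_le_one` (`ArmEventsProofs.lean`), `exists_rpow_le_critTwoArmProb`,
`exists_critTwoArmProb_le_rpow` (`ArmEventsAPriori.lean`).

## References

* S. Smirnov, W. Werner, *Critical exponents for two-dimensional percolation*, Math. Res.
  Lett. 8 (2001), 729–744; arXiv:math/0109120, §4: (9), (15), (16) and the sentence following
  (16) (p. 9 of the arXiv text) [SmirnovWernerMRL2001].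
-/

noncomputable section

open Filter Topology MeasureTheory

namespace Literature.Probability.Percolation

open LatticeModels

namespace TwoArmScalingLimit

variable {L : ℕ → ℕ → ℝ}

/-! ### Ratio-only dependence of the limits (SW (16): "depends on the ratio `R/r` only") -/

/-- Along integer dilations the limits are automatically scale invariant: `b_2(ρ k r, ρ k R)` is
a subsequence of `b_2(ρ r, ρ R)`, so `L(k r, k R) = L(r, R)`. [cite: SmirnovWernerMRL2001, §4 (16)] -/
theorem limit_mul
    (hlim : ∀ r R : ℕ, 1 ≤ r → r < R →
      Tendsto (fun ρ : ℕ => critTwoArmProb (ρ * r) (ρ * R)) atTop (𝓝 (L r R)))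
    {r R k : ℕ} (hr : 1 ≤ r) (hrR : r < R) (hk : 1 ≤ k) :
    L (k * r) (k * R) = L r R := by
  have hkr : 1 ≤ k * r := le_trans hk (Nat.le_mul_of_pos_right k hr)
  have hkR : k * r < k * R := Nat.mul_lt_mul_of_pos_left hrR hk
  have h1 : Tendsto (fun ρ : ℕ => critTwoArmProb (ρ * (k * r)) (ρ * (k * R))) atTop
      (𝓝 (L (k * r) (k * R))) := hlim (k * r) (k * R) hkr hkR
  have hsub : Tendsto (fun ρ : ℕ => ρ * k) atTop atTop :=
    tendsto_atTop_mono (fun ρ => Nat.le_mul_of_pos_right ρ hk) tendsto_id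
  have h2 : Tendsto (fun ρ : ℕ => critTwoArmProb (ρ * (k * r)) (ρ * (k * R))) atTop
      (𝓝 (L r R)) := by
    have h := (hlim r R hr hrR).comp hsub
    simpa only [Function.comp_def, mul_assoc] using h
  exact tendsto_nhds_unique h1 h2

/-- The limits depend on the ratio only: if `R/r = R'/r'`, i.e. `R r' = R' r`, then
`L(r, R) = L(r', R')` (both equal `L(r r', R r')`). [cite: SmirnovWernerMRL2001, §4 (16)] -/
theorem limit_eq_of_ratio_eq
    (hlim : ∀ r R : ℕ, 1 ≤ r → r < R →
      Tendsto (fun ρ : ℕ => critTwoArmProb (ρ * r) (ρ * R)) atTop (𝓝 (L r R)))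
    {r R r' R' : ℕ} (hr : 1 ≤ r) (hrR : r < R) (hr' : 1 ≤ r') (hr'R' : r' < R')
    (h : R * r' = R' * r) : L r R = L r' R' := by
  rw [← limit_mul hlim hr hrR hr', ← limit_mul hlim hr' hr'R' hr]
  rw [Nat.mul_comm r' r, Nat.mul_comm r' R, h, Nat.mul_comm R' r]

/-! ### Monotonicity of the limits -/

/-- The limits are non-increasing in the outer radius (from `polyArmProb_anti_holds`, SW §3:
"`a_j(r, R)` is decreasing in `R`"). [cite: SmirnovWernerMRL2001, §3] -/
theorem limit_anti_right
    (hlim : ∀ r R : ℕ, 1 ≤ r → r < R →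
      Tendsto (fun ρ : ℕ => critTwoArmProb (ρ * r) (ρ * R)) atTop (𝓝 (L r R)))
    {r R R' : ℕ} (hr : 1 ≤ r) (hrR : r < R) (hRR' : R ≤ R') : L r R' ≤ L r R :=
  le_of_tendsto_of_tendsto (hlim r R' hr (lt_of_lt_of_le hrR hRR')) (hlim r R hr hrR)
    (Eventually.of_forall fun ρ =>
      polyArmProb_anti_holds ![true, false] (Nat.mul_le_mul_left ρ hrR.le)
        (Nat.mul_le_mul_left ρ hRR'))

/-- The limits are non-decreasing in the inner radius (from `armEvent_mono_left`: arms across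
`Λ_R ∖ Λ_r` contain arms across `Λ_R ∖ Λ_{r'}` for `r ≤ r'`). [cite: SmirnovWernerMRL2001, §3] -/
theorem limit_mono_left
    (hlim : ∀ r R : ℕ, 1 ≤ r → r < R →
      Tendsto (fun ρ : ℕ => critTwoArmProb (ρ * r) (ρ * R)) atTop (𝓝 (L r R)))
    {r r' R : ℕ} (hr : 1 ≤ r) (hrr' : r ≤ r') (hr'R : r' < R) : L r R ≤ L r' R :=
  le_of_tendsto_of_tendsto (hlim r R hr (lt_of_le_of_lt hrr' hr'R)) (hlim r' R (hr.trans hrr') hr'R)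
    (Eventually.of_forall fun ρ => by
      simp only [critTwoArmProb, polyArmProb]
      exact measureReal_mono
        (armEvent_mono_left _ (Nat.mul_le_mul_left ρ hrr') (Nat.mul_le_mul_left ρ hr'R.le))
        (measure_ne_top _ _))

/-- The limits are non-increasing in the ratio: if `R/r ≤ R'/r'`, i.e. `R r' ≤ R' r`, then
`L(r', R') ≤ L(r, R)` (compare `L(r r', R' r) ≤ L(r r', R r')` at the common inner radius
`r r'`). [cite: SmirnovWernerMRL2001, §3 and §4 (16)] -/
theorem limit_anti_ratio
    (hlim : ∀ r R : ℕ, 1 ≤ r → r < R →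
      Tendsto (fun ρ : ℕ => critTwoArmProb (ρ * r) (ρ * R)) atTop (𝓝 (L r R)))
    {r R r' R' : ℕ} (hr : 1 ≤ r) (hrR : r < R) (hr' : 1 ≤ r') (hr'R' : r' < R')
    (h : R * r' ≤ R' * r) : L r' R' ≤ L r R := by
  rw [← limit_mul hlim hr hrR hr', ← limit_mul hlim hr' hr'R' hr]
  have hrr' : 1 ≤ r * r' := le_trans hr (Nat.le_mul_of_pos_right r hr')
  have hlt : r * r' < r' * R := by
    rw [Nat.mul_comm r r']
    exact Nat.mul_lt_mul_of_pos_left hrR hr'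
  have hle : r' * R ≤ r * R' := by
    rw [Nat.mul_comm r' R, Nat.mul_comm r R']
    exact h
  have := limit_anti_right hlim hrr' hlt hle
  rwa [Nat.mul_comm r r'] at this ⊢

/-! ### A-priori bounds of the limits (SW p. 9: "`b'_j(R) ≥ const R^{-ζ}`") -/

/-- **RSW lower bound in the limit** (SW, sentence following (16): "By standard RSW theory,
`b_j(r, R)` is bounded from below by a power of `R/r`, hence `b'_j(R) ≥ const R^{-ζ}` for some
`ζ > 0`"): there are `c, ζ > 0` with `c (r/R)^ζ ≤ L(r, R)` for all integers `1 ≤ r < R`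
(the bound `exists_rpow_le_critTwoArmProb` is scale invariant and passes to the limit).
[cite: SmirnovWernerMRL2001, §4.2 (sentence following (16), p. 9)] -/
theorem exists_rpow_le_limit
    (hlim : ∀ r R : ℕ, 1 ≤ r → r < R →
      Tendsto (fun ρ : ℕ => critTwoArmProb (ρ * r) (ρ * R)) atTop (𝓝 (L r R))) :
    ∃ c ζ : ℝ, 0 < c ∧ 0 < ζ ∧ ∀ r R : ℕ, 1 ≤ r → r < R → c * ((r : ℝ) / R) ^ ζ ≤ L r R := by
  obtain ⟨c, ζ, hc, hζ, h⟩ := exists_rpow_le_critTwoArmProb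
  refine ⟨c, ζ, hc, hζ, fun r R hr hrR => ge_of_tendsto (hlim r R hr hrR) ?_⟩
  filter_upwards [eventually_ge_atTop 1] with ρ hρ
  have hρr : 1 ≤ ρ * r := le_trans hρ (Nat.le_mul_of_pos_right ρ hr)
  have hb := h (ρ * r) (ρ * R) hρr (Nat.mul_le_mul_left ρ hrR.le)
  have hρ' : (0 : ℝ) < ρ := by exact_mod_cast hρ
  have hR' : (0 : ℝ) < R := by exact_mod_cast (lt_of_le_of_lt (Nat.zero_le r) hrR)
  have hcast : (((ρ * r : ℕ) : ℝ) / ((ρ * R : ℕ) : ℝ)) = (r : ℝ) / R := by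
    push_cast
    rw [mul_div_mul_left _ _ hρ'.ne']
  rwa [hcast] at hb

/-- **A-priori upper bound in the limit**: there are `C, α > 0` with `L(r, R) ≤ C (r/R)^α` for
all integers `1 ≤ r < R` (`exists_critTwoArmProb_le_rpow` passes to the limit).
[cite: Nolin2008, Prop. 14 (arXiv 0711.4948: Prop. 13)] -/
theorem exists_limit_le_rpow
    (hlim : ∀ r R : ℕ, 1 ≤ r → r < R →
      Tendsto (fun ρ : ℕ => critTwoArmProb (ρ * r) (ρ * R)) atTop (𝓝 (L r R))) :
    ∃ C α : ℝ, 0 < C ∧ 0 < α ∧ ∀ r R : ℕ, 1 ≤ r → r < R → L r R ≤ C * ((r : ℝ) / R) ^ α := by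
  obtain ⟨C, α, hC, hα, h⟩ := exists_critTwoArmProb_le_rpow
  refine ⟨C, α, hC, hα, fun r R hr hrR => le_of_tendsto (hlim r R hr hrR) ?_⟩
  filter_upwards [eventually_ge_atTop 1] with ρ hρ
  have hρr : 1 ≤ ρ * r := le_trans hρ (Nat.le_mul_of_pos_right ρ hr)
  have hb := h (ρ * r) (ρ * R) hρr (Nat.mul_le_mul_left ρ hrR.le)
  have hρ' : (0 : ℝ) < ρ := by exact_mod_cast hρ
  have hcast : (((ρ * r : ℕ) : ℝ) / ((ρ * R : ℕ) : ℝ)) = (r : ℝ) / R := by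
    push_cast
    rw [mul_div_mul_left _ _ hρ'.ne']
  rwa [hcast] at hb

/-- The limits are positive (RSW lower bound). [cite: SmirnovWernerMRL2001, §4.2 (sentence following (16), p. 9)] -/
theorem limit_pos
    (hlim : ∀ r R : ℕ, 1 ≤ r → r < R →
      Tendsto (fun ρ : ℕ => critTwoArmProb (ρ * r) (ρ * R)) atTop (𝓝 (L r R)))
    {r R : ℕ} (hr : 1 ≤ r) (hrR : r < R) : 0 < L r R := by
  obtain ⟨c, ζ, hc, _, h⟩ := exists_rpow_le_limit hlim
  have hr' : (0 : ℝ) < r := by exact_mod_cast hr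
  have hR' : (0 : ℝ) < R := by exact_mod_cast (lt_of_le_of_lt (Nat.zero_le r) hrR)
  exact lt_of_lt_of_le (mul_pos hc (Real.rpow_pos_of_pos (div_pos hr' hR') ζ)) (h r R hr hrR)

/-- The limits are at most `1` (limits of probabilities). [folklore] -/
theorem limit_le_one
    (hlim : ∀ r R : ℕ, 1 ≤ r → r < R →
      Tendsto (fun ρ : ℕ => critTwoArmProb (ρ * r) (ρ * R)) atTop (𝓝 (L r R)))
    {r R : ℕ} (hr : 1 ≤ r) (hrR : r < R) : L r R ≤ 1 :=
  le_of_tendsto' (hlim r R hr hrR) fun _ => polyArmProb_le_one _ _ _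

/-! ### The exponent: from integer ratios to all integer pairs of large ratio -/

/-- `log (n + 1) / log n → 1`. [folklore] -/
theorem tendsto_log_succ_div_log :
    Tendsto (fun n : ℕ => Real.log ((n : ℝ) + 1) / Real.log n) atTop (𝓝 1) := by
  have hlogn : Tendsto (fun n : ℕ => Real.log (n : ℝ)) atTop atTop :=
    Real.tendsto_log_atTop.comp tendsto_natCast_atTop_atTop
  have hdiff : Tendsto (fun n : ℕ => Real.log ((n : ℝ) + 1) - Real.log n) atTop (𝓝 0) := by
    have h1 : Tendsto (fun n : ℕ => 1 + 1 / (n : ℝ)) atTop (𝓝 (1 + 0)) :=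
      tendsto_const_nhds.add tendsto_one_div_atTop_nhds_zero_nat
    rw [add_zero] at h1
    have h2 : Tendsto (fun n : ℕ => Real.log (1 + 1 / (n : ℝ))) atTop (𝓝 (Real.log 1)) :=
      (Real.continuousAt_log one_ne_zero).tendsto.comp h1
    rw [Real.log_one] at h2
    refine h2.congr' ?_
    filter_upwards [eventually_ge_atTop 1] with n hn
    have hn' : (0 : ℝ) < n := by exact_mod_cast hn
    rw [← Real.log_div (by positivity) hn'.ne', add_div, div_self hn'.ne']
  have h3 : Tendsto (fun n : ℕ => 1 + (Real.log ((n : ℝ) + 1) - Real.log n) / Real.log n) atTop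
      (𝓝 (1 + 0)) := tendsto_const_nhds.add (hdiff.div_atTop hlogn)
  rw [add_zero] at h3
  refine h3.congr' ?_
  filter_upwards [eventually_ge_atTop 2] with n hn
  have hn' : (2 : ℝ) ≤ n := by exact_mod_cast hn
  have hlog : Real.log (n : ℝ) ≠ 0 := ne_of_gt (Real.log_pos (by linarith))
  field_simp
  ring

/-- **The exponent transfers from integer ratios to all integer pairs** (monotonicity sandwich
`L(1, n+1) ≤ L(r, R) ≤ L(1, n)` for `n r ≤ R < (n+1) r`): if `log L(1, n) / log n → -1/4`
along the integers, then for every `ε > 0` there is `M` with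
`|log L(r, R) / log (R/r) + 1/4| < ε` for all integers `1 ≤ r < R` with `R ≥ M r`.
[cite: SmirnovWernerMRL2001, §4 (9), (16)] -/
theorem exponent_of_nat
    (hlim : ∀ r R : ℕ, 1 ≤ r → r < R →
      Tendsto (fun ρ : ℕ => critTwoArmProb (ρ * r) (ρ * R)) atTop (𝓝 (L r R)))
    (hexp : Tendsto (fun n : ℕ => Real.log (L 1 n) / Real.log n) atTop (𝓝 (-(1 / 4)))) :
    ∀ ε > 0, ∃ M : ℕ, ∀ r R : ℕ, 1 ≤ r → r < R → M * r ≤ R →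
      |Real.log (L r R) / Real.log ((R : ℝ) / r) - (-(1 / 4))| < ε := by
  intro ε hε
  -- the two comparison sequences `u_n = log L(1,n) / log (n+1)`, `v_n = log L(1,n+1) / log n`
  have hu : Tendsto (fun n : ℕ => Real.log (L 1 n) / Real.log ((n : ℝ) + 1)) atTop
      (𝓝 (-(1 / 4))) := by
    have h := hexp.div tendsto_log_succ_div_log one_ne_zero
    rw [div_one] at h
    refine h.congr' ?_
    filter_upwards [eventually_ge_atTop 2] with n hn
    have hn' : (2 : ℝ) ≤ n := by exact_mod_cast hn
    have hlog : Real.log (n : ℝ) ≠ 0 := ne_of_gt (Real.log_pos (by linarith))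
    have hlog1 : Real.log ((n : ℝ) + 1) ≠ 0 := ne_of_gt (Real.log_pos (by linarith))
    simp only [Pi.div_apply]
    field_simp
  have hv : Tendsto (fun n : ℕ => Real.log (L 1 (n + 1)) / Real.log n) atTop
      (𝓝 (-(1 / 4))) := by
    have h1 : Tendsto (fun n : ℕ => Real.log (L 1 (n + 1)) / Real.log ((n : ℝ) + 1)) atTop
        (𝓝 (-(1 / 4))) := by
      have h := hexp.comp (tendsto_add_atTop_nat 1)
      simpa only [Function.comp_def, Nat.cast_succ] using h
    have h := h1.mul tendsto_log_succ_div_log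
    rw [mul_one] at h
    refine h.congr' ?_
    filter_upwards [eventually_ge_atTop 2] with n hn
    have hn' : (2 : ℝ) ≤ n := by exact_mod_cast hn
    have hlog : Real.log (n : ℝ) ≠ 0 := ne_of_gt (Real.log_pos (by linarith))
    have hlog1 : Real.log ((n : ℝ) + 1) ≠ 0 := ne_of_gt (Real.log_pos (by linarith))
    field_simp
  obtain ⟨M, hM⟩ := eventually_atTop.1
    (((Metric.tendsto_nhds.1 hu) ε hε).and ((((Metric.tendsto_nhds.1 hv) ε hε)).and
      (eventually_ge_atTop 2)))
  refine ⟨M, fun r R hr hrR hMR => ?_⟩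
  -- `n = ⌊R / r⌋`, so that `n r ≤ R < (n + 1) r` and `n ≥ M ≥ 2`
  have hr0 : 0 < r := hr
  set n : ℕ := R / r with hn_def
  have hMn : M ≤ n := (Nat.le_div_iff_mul_le hr0).2 hMR
  obtain ⟨hun, hvn, hn2⟩ := hM n hMn
  have hnr : n * r ≤ R := Nat.div_mul_le_self R r
  have hRn : R < (n + 1) * r := (Nat.div_lt_iff_lt_mul hr0).1 (Nat.lt_succ_self _)
  have hn1 : 1 < n := hn2
  have hn1' : 1 < n + 1 := by omega
  -- the sandwich `L(1, n+1) ≤ L(r, R) ≤ L(1, n)`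
  have hup : L r R ≤ L 1 n :=
    limit_anti_ratio hlim le_rfl hn1 hr hrR (by simpa [Nat.mul_one] using hnr)
  have hlow : L 1 (n + 1) ≤ L r R :=
    limit_anti_ratio hlim hr hrR le_rfl hn1' (by simpa [Nat.mul_one] using hRn.le)
  have hpos : 0 < L r R := limit_pos hlim hr hrR
  have hpos1 : 0 < L 1 (n + 1) := limit_pos hlim le_rfl hn1'
  have hle1 : L 1 n ≤ 1 := limit_le_one hlim le_rfl hn1
  -- logarithms
  have hlog_up : Real.log (L r R) ≤ Real.log (L 1 n) := Real.log_le_log hpos hup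
  have hlog_low : Real.log (L 1 (n + 1)) ≤ Real.log (L r R) := Real.log_le_log hpos1 hlow
  have hlogn_nonpos : Real.log (L 1 n) ≤ 0 := Real.log_nonpos (hpos.trans_le hup).le hle1
  have hlogn1_nonpos : Real.log (L 1 (n + 1)) ≤ 0 :=
    Real.log_nonpos hpos1.le (hlow.trans (hup.trans hle1))
  have hr' : (0 : ℝ) < r := by exact_mod_cast hr
  have hn' : (2 : ℝ) ≤ n := by exact_mod_cast hn2
  have hratio_ge : (n : ℝ) ≤ (R : ℝ) / r := by
    rw [le_div_iff₀ hr']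
    exact_mod_cast hnr
  have hratio_le : (R : ℝ) / r ≤ (n : ℝ) + 1 := by
    rw [div_le_iff₀ hr']
    exact_mod_cast hRn.le
  have hlogn_pos : 0 < Real.log (n : ℝ) := Real.log_pos (by linarith)
  have hlogq_ge : Real.log (n : ℝ) ≤ Real.log ((R : ℝ) / r) :=
    Real.log_le_log (by linarith) hratio_ge
  have hlogq_le : Real.log ((R : ℝ) / r) ≤ Real.log ((n : ℝ) + 1) :=
    Real.log_le_log (by linarith) hratio_le
  have hlogq_pos : 0 < Real.log ((R : ℝ) / r) := hlogn_pos.trans_le hlogq_ge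
  -- upper comparison with `u_n`
  have h_upper : Real.log (L r R) / Real.log ((R : ℝ) / r)
      ≤ Real.log (L 1 n) / Real.log ((n : ℝ) + 1) :=
    calc Real.log (L r R) / Real.log ((R : ℝ) / r)
        ≤ Real.log (L 1 n) / Real.log ((R : ℝ) / r) :=
          div_le_div_of_nonneg_right hlog_up hlogq_pos.le
      _ ≤ Real.log (L 1 n) / Real.log ((n : ℝ) + 1) :=
          TwoArmAssembly.div_le_div_of_nonpos_left' hlogn_nonpos hlogq_pos hlogq_le
  -- lower comparison with `v_n`
  have h_lower : Real.log (L 1 (n + 1)) / Real.log (n : ℝ)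
      ≤ Real.log (L r R) / Real.log ((R : ℝ) / r) :=
    calc Real.log (L 1 (n + 1)) / Real.log (n : ℝ)
        ≤ Real.log (L 1 (n + 1)) / Real.log ((R : ℝ) / r) :=
          TwoArmAssembly.div_le_div_of_nonpos_left' hlogn1_nonpos hlogn_pos hlogq_ge
      _ ≤ Real.log (L r R) / Real.log ((R : ℝ) / r) :=
          div_le_div_of_nonneg_right hlog_low hlogq_pos.le
  rw [Real.dist_eq] at hun hvn
  rw [abs_sub_lt_iff] at hun hvn ⊢
  constructor <;> linarith [hun.1, hun.2, hvn.1, hvn.2]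

end TwoArmScalingLimit

open TwoArmScalingLimit in
/-- **The fact from (16)ℕ and the exponent over integer pairs.** If the two-arm probabilities of
the integer annuli converge, `b_2(ρ r, ρ R) → L(r, R)` for all `1 ≤ r < R`, and
`log L(r, R) / log (R/r) → -1/4` as `R/r → ∞` over integer pairs, then
`SmirnovWerner2001_twoArm_scalingLimit` holds, with `b'(R/r) := L(r, R)` on the rationals `> 1`
(well defined by `limit_eq_of_ratio_eq`) and `b'(λ) := λ^{-1/4}` elsewhere.
[cite: SmirnovWernerMRL2001, §4 (9), (16)] -/
theorem SmirnovWerner2001_twoArm_scalingLimit_of_limits (L : ℕ → ℕ → ℝ)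
    (hlim : ∀ r R : ℕ, 1 ≤ r → r < R →
      Tendsto (fun ρ : ℕ => critTwoArmProb (ρ * r) (ρ * R)) atTop (𝓝 (L r R)))
    (hexp : ∀ ε > 0, ∃ M : ℕ, ∀ r R : ℕ, 1 ≤ r → r < R → M * r ≤ R →
      |Real.log (L r R) / Real.log ((R : ℝ) / r) - (-(1 / 4))| < ε) :
    SmirnovWerner2001_twoArm_scalingLimit := by
  classical
  -- rational ratios `l = R/r` of integer pairs `1 ≤ r < R`, with a chosen representative
  let P : ℝ → Prop := fun l => ∃ p : ℕ × ℕ, 1 ≤ p.1 ∧ p.1 < p.2 ∧ (p.2 : ℝ) / p.1 = l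
  let b' : ℝ → ℝ := fun l => if h : P l then L h.choose.1 h.choose.2 else l ^ (-(1 / 4) : ℝ)
  have hb'P : ∀ {l} (h : P l), b' l = L h.choose.1 h.choose.2 := fun h => dif_pos h
  refine ⟨b', fun r R hr hrR => ?_, ?_⟩
  · -- first clause: `b'(R/r) = L(r, R)` by ratio-only dependence
    have hP : P ((R : ℝ) / r) := ⟨(r, R), hr, hrR, rfl⟩
    obtain ⟨h1, h2, h3⟩ := hP.choose_spec
    have hr' : (0 : ℝ) < r := by exact_mod_cast hr
    have h1' : (0 : ℝ) < hP.choose.1 := by exact_mod_cast h1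
    have hcross : hP.choose.2 * r = R * hP.choose.1 := by
      rw [div_eq_div_iff h1'.ne' hr'.ne'] at h3
      exact_mod_cast h3
    rw [hb'P hP, limit_eq_of_ratio_eq hlim h1 h2 hr hrR hcross]
    exact hlim r R hr hrR
  · -- second clause: the exponent along the reals
    rw [Metric.tendsto_atTop]
    intro ε hε
    obtain ⟨M, hM⟩ := hexp ε hε
    refine ⟨max (M : ℝ) 2, fun l hl => ?_⟩
    have hl2 : (2 : ℝ) ≤ l := le_trans (le_max_right _ _) hl
    have hlM : (M : ℝ) ≤ l := le_trans (le_max_left _ _) hl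
    rw [Real.dist_eq]
    by_cases hPl : P l
    · obtain ⟨h1, h2, h3⟩ := hPl.choose_spec
      have h1' : (0 : ℝ) < hPl.choose.1 := by exact_mod_cast h1
      have hMul : M * hPl.choose.1 ≤ hPl.choose.2 := by
        have : (M : ℝ) * hPl.choose.1 ≤ hPl.choose.2 := by
          rw [← le_div_iff₀ h1', h3]
          exact hlM
        exact_mod_cast this
      have h := hM _ _ h1 h2 hMul
      rw [h3] at h
      rw [hb'P hPl]
      exact h
    · have hb : b' l = l ^ (-(1 / 4) : ℝ) := dif_neg hPl
      have hl0 : (0 : ℝ) < l := by linarith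
      have hlog : Real.log l ≠ 0 := ne_of_gt (Real.log_pos (by linarith))
      rw [hb, Real.log_rpow hl0, mul_div_assoc, div_self hlog, mul_one, sub_self, abs_zero]
      exact hε

open TwoArmScalingLimit in
/-- **The fact from Smirnov–Werner's (16) and (9) on integer data**: if `b_2(ρ r, ρ R) → L(r, R)`
for all integers `1 ≤ r < R` (SW (16) for the integer annuli) and `log L(1, n) / log n → -1/4`
along the integers (SW (9) with (15), `j = 2`, integer ratios), then
`SmirnovWerner2001_twoArm_scalingLimit` holds. [cite: SmirnovWernerMRL2001, §4 (9), (15), (16)] -/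
theorem SmirnovWerner2001_twoArm_scalingLimit_of_limits_nat (L : ℕ → ℕ → ℝ)
    (hlim : ∀ r R : ℕ, 1 ≤ r → r < R →
      Tendsto (fun ρ : ℕ => critTwoArmProb (ρ * r) (ρ * R)) atTop (𝓝 (L r R)))
    (hexp : Tendsto (fun n : ℕ => Real.log (L 1 n) / Real.log n) atTop (𝓝 (-(1 / 4)))) :
    SmirnovWerner2001_twoArm_scalingLimit :=
  SmirnovWerner2001_twoArm_scalingLimit_of_limits L hlim (exponent_of_nat hlim hexp)

/-- **`SmirnovWerner2001_twoArm_scalingLimit` ⇔ (16)ℕ ∧ (9)ℕ.** The named fact is equivalent to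
the conjunction of Smirnov–Werner's two printed statements read on integer data: the two-arm
probabilities of the integer annuli `Λ_{ρR} ∖ Λ_{ρr}` converge as `ρ → ∞` for all `1 ≤ r < R`,
and the limits along `r = 1` have exponent `-1/4`: `log L(1, n) / log n → -1/4`. (The forward
direction reads `L(r, R) := b'(R/r)` off the fact.) [cite: SmirnovWernerMRL2001, §4 (9), (15), (16)] -/
theorem SmirnovWerner2001_twoArm_scalingLimit_iff :
    SmirnovWerner2001_twoArm_scalingLimit ↔ ∃ L : ℕ → ℕ → ℝ,
      (∀ r R : ℕ, 1 ≤ r → r < R →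
        Tendsto (fun ρ : ℕ => critTwoArmProb (ρ * r) (ρ * R)) atTop (𝓝 (L r R))) ∧
      Tendsto (fun n : ℕ => Real.log (L 1 n) / Real.log n) atTop (𝓝 (-(1 / 4))) := by
  constructor
  · rintro ⟨b', hlim, hexp⟩
    refine ⟨fun r R => b' ((R : ℝ) / r), hlim, ?_⟩
    have h := hexp.comp tendsto_natCast_atTop_atTop
    simpa only [Function.comp_def, Nat.cast_one, div_one] using h
  · rintro ⟨L, hlim, hexp⟩
    exact SmirnovWerner2001_twoArm_scalingLimit_of_limits_nat L hlim hexp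

end Literature.Probability.Percolation
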